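import Summits.CriticalPhenomena.CardyFormulaZ2.Theses.CardyQContinuation
import Literature.Analysis.Potential.HarmonicMeasure
import Literature.Analysis.Pluripotential.NonPluripolarMongeAmpereMassSiuProofs
import Literature.Probability.RandomPlanarGeometry.ConformalMap

/-!
# Crux `IsingJetsConformal`, stub `stub_loopSymmetricLimit_harmonicMeasureTransport`:
# transporting a harmonic minorant from the disc bounds the Perron harmonic measure from below
# (route `CardyQContinuation`, item stmt-CriticalPhenomena-5560)

The Chelkak–Smirnov crossing theorem (named fact
`Literature.Probability.LatticeModels.ChelkakSmirnov2012_fkIsingQuadrilateralCrossing`) asks that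
the harmonic measure of each wired arc be bounded below, with the tree's PERRON harmonic measure
`Literature.Analysis.Potential.harmonicMeasure D z B = (min (H_D 1_B (z)) 1).toReal`
(`HarmonicMeasure.lean`). This file provides the lower-bound mechanism for a Jordan domain `D`
with Riemann map `f : 𝔻 → D` and Carathéodory extension `Φ` (the data produced by
`JordanDomain.exists_continuousOn_extension`): if `F` is holomorphic on the disc with `Re F ≤ 1`
and `Re F → 0⁺`-small at every boundary point `ζ ∈ ∂𝔻` with `Φ ζ ∉ A`, then
`Re F (w) ≤ ω_D(f w, A)` for every `w ∈ 𝔻`.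

Proof. `v z := Re F (f⁻¹ z)` (as an `EReal`) belongs to the Perron family of the datum `1_A`
(`mem_perronFamily_of_isBounded`): (a) `F ∘ f⁻¹` is holomorphic on `D`, so `Re (F ∘ f⁻¹)` is
continuous with the mean-value property on closed discs in `D` (Mathlib's
`DiffContOnCl.circleAverage` and linearity of `circleAverage` in `Complex.reCLM`), hence
subharmonic (`isSubharmonicOn_coe_of_circleAverage_eq`); (b) at `ζ = Φ ξ ∈ ∂D`, `ξ ∈ ∂𝔻`:
if `Φ ξ ∈ A` the bound `v ≤ 1` suffices; otherwise `f⁻¹ → ξ` within `𝔻` along `𝓝[D] (Φ ξ)`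
(the inverse of the continuous injection `Φ` of the compact closed disc is continuous: closed
subsets of the disc missing `ξ` have compact images missing `Φ ξ`), so the hypothesis on `F`
transports to `limsup v ≤ ε` for every `ε > 0`. Then `le_harmonicMeasure_of_mem` at `z = f w`.

References: T. Ransford, *Potential Theory in the Complex Plane* (1995), Def. 4.1.1, §4.3
(Table 4.1: lower bounds by members of the Perron family); Ch. Pommerenke, *Boundary Behaviour
of Conformal Maps* (1992), Thm. 2.6 (Carathéodory).
-/

namespace Summit.CriticalPhenomena.CardyFormulaZ2.Theorems.CardyQContinuation

open Set Metric Filter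
open scoped Topology
open Literature.Analysis.Potential Literature.Analysis.Pluripotential
open Literature.Probability.RandomPlanarGeometry

noncomputable section

namespace HarmonicMeasureTransport

/-- **Mean-value property of the real part of a holomorphic function**: if `H` is holomorphic on
`U ⊇ D̄(c, R)`, `R > 0`, then the circle average of `Re H` over `∂D(c, R)` is `Re H (c)`
(Mathlib's `DiffContOnCl.circleAverage` pushed through the real-linear map `Complex.reCLM`).
[folklore] -/
theorem circleAverage_re_eq {U : Set ℂ} {H : ℂ → ℂ} (hH : DifferentiableOn ℂ H U) {c : ℂ}
    {R : ℝ} (hR : 0 < R) (hcl : closedBall c R ⊆ U) :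
    Real.circleAverage (fun z ↦ (H z).re) c R = (H c).re := by
  have h1 : DiffContOnCl ℂ H (ball c |R|) := hH.diffContOnCl_ball (by rwa [abs_of_pos hR])
  have h2 : CircleIntegrable H c R := by
    refine (hH.continuousOn.mono ?_).circleIntegrable'
    rw [abs_of_pos hR]
    exact sphere_subset_closedBall.trans hcl
  have h3 := Complex.reCLM.circleAverage_comp_comm h2
  rw [h1.circleAverage] at h3
  simpa [Function.comp_def] using h3

/-- **Subharmonicity of the transported real part.** For a conformal map `f : 𝔻 → D` onto a
Jordan domain and `F` holomorphic on `𝔻`, the function `z ↦ Re F (f⁻¹ z)` is subharmonic on `D`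
(it is the real part of the holomorphic `F ∘ f⁻¹`: continuous with the mean-value property).
[folklore] -/
theorem isSubharmonicOn_re_comp_symm (D : JordanDomain)
    (f : ConformalEquiv (ball (0 : ℂ) 1) D.carrier) {F : ℂ → ℂ}
    (hF : DifferentiableOn ℂ F (ball 0 1)) :
    IsSubharmonicOn (fun z ↦ (((F (f.symm z)).re : ℝ) : EReal)) D.carrier := by
  have hH : DifferentiableOn ℂ (fun z ↦ F (f.symm z)) D.carrier :=
    hF.comp f.symm.differentiableOn_coe f.symm_mapsTo
  refine isSubharmonicOn_coe_of_circleAverage_eq (h := fun z ↦ (F (f.symm z)).re) ?_ ?_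
  · exact Complex.continuous_re.comp_continuousOn hH.continuousOn
  · intro c R hR hcl
    exact circleAverage_re_eq hH hR hcl

/-- **Boundary continuity of `f⁻¹` through the Carathéodory extension.** If `Φ` is continuous and
injective on the closed unit disc and extends `f : 𝔻 → D`, then for every `ξ` in the closed disc,
`f⁻¹ z → ξ` within `𝔻` as `z → Φ ξ` within `D`: a closed part of the disc avoiding `ξ` has compact
image avoiding `Φ ξ`, and `Φ (f⁻¹ z) = z` on `D`. [folklore] -/
theorem tendsto_symm_nhdsWithin (D : JordanDomain)
    (f : ConformalEquiv (ball (0 : ℂ) 1) D.carrier) {Φ : ℂ → ℂ}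
    (hΦc : ContinuousOn Φ (closedBall 0 1)) (hΦf : EqOn Φ f (ball 0 1))
    (hinj : InjOn Φ (closedBall 0 1)) {ξ : ℂ} (hξ : ξ ∈ closedBall (0 : ℂ) 1) :
    Tendsto f.symm (𝓝[D.carrier] (Φ ξ)) (𝓝[ball 0 1] ξ) := by
  refine tendsto_nhdsWithin_iff.2
    ⟨?_, eventually_mem_nhdsWithin.mono fun z hz ↦ f.symm_mapsTo hz⟩
  rw [_root_.tendsto_nhds]
  intro W hWo hξW
  have hK : IsCompact (closedBall (0 : ℂ) 1 \ W) := (isCompact_closedBall 0 1).diff hWo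
  have hC : IsClosed (Φ '' (closedBall (0 : ℂ) 1 \ W)) :=
    (hK.image_of_continuousOn (hΦc.mono Set.sdiff_subset)).isClosed
  have hnot : Φ ξ ∉ Φ '' (closedBall (0 : ℂ) 1 \ W) := by
    rintro ⟨y, ⟨hyK, hyW⟩, hy⟩
    exact hyW (hinj hyK hξ hy ▸ hξW)
  filter_upwards [inter_mem_nhdsWithin D.carrier (hC.isOpen_compl.mem_nhds hnot)]
    with z hz
  obtain ⟨hzD, hzC⟩ := hz
  by_contra hW
  have hzb : f.symm z ∈ ball (0 : ℂ) 1 := f.symm_mapsTo hzD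
  refine hzC ⟨f.symm z, ⟨ball_subset_closedBall hzb, hW⟩, ?_⟩
  rw [hΦf hzb, f.apply_symm_apply hzD]

/-- **Boundary `limsup` of the transported real part.** With `Φ` the Carathéodory extension of
`f : 𝔻 → D` (continuous on the closed disc, `= f` on `𝔻`, bijective `D̄(0,1) → D̄` and
`∂𝔻 → ∂D`), `Re F ≤ 1` on `𝔻` and `Re F` eventually `< ε` near every `ζ ∈ ∂𝔻` with `Φ ζ ∉ A`
(all `ε > 0`): `limsup_{z → ζ, z ∈ D} Re F (f⁻¹ z) ≤ 1_A(ζ)` at every `ζ ∈ ∂D`. [folklore] -/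
theorem limsup_le_indicator (D : JordanDomain)
    (f : ConformalEquiv (ball (0 : ℂ) 1) D.carrier) {Φ : ℂ → ℂ}
    (hΦc : ContinuousOn Φ (closedBall 0 1)) (hΦf : EqOn Φ f (ball 0 1))
    (hΦbij : BijOn Φ (closedBall 0 1) (closure D.carrier))
    (hΦfr : BijOn Φ (sphere 0 1) (frontier D.carrier)) {A : Set ℂ} {F : ℂ → ℂ}
    (hF1 : ∀ w ∈ ball (0 : ℂ) 1, (F w).re ≤ 1)
    (hFA : ∀ ζ ∈ sphere (0 : ℂ) 1, Φ ζ ∉ A → ∀ ε : ℝ, 0 < ε →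
      ∀ᶠ w in 𝓝[ball 0 1] ζ, (F w).re < ε)
    {ζ : ℂ} (hζ : ζ ∈ frontier D.carrier) :
    limsup (fun z ↦ (((F (f.symm z)).re : ℝ) : EReal)) (𝓝[D.carrier] ζ) ≤ A.indicator 1 ζ := by
  obtain ⟨ξ, hξS, rfl⟩ := hΦfr.surjOn hζ
  by_cases hA : Φ ξ ∈ A
  · rw [indicator_of_mem hA, Pi.one_apply]
    refine limsup_le_of_le (by isBoundedDefault) ?_
    exact eventually_mem_nhdsWithin.mono fun z hz ↦ by
      exact_mod_cast hF1 _ (f.symm_mapsTo hz)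
  · rw [indicator_of_notMem hA]
    have hT := tendsto_symm_nhdsWithin D f hΦc hΦf hΦbij.injOn (sphere_subset_closedBall hξS)
    refine le_of_forall_gt_imp_ge_of_dense fun c hc ↦ ?_
    obtain ⟨ε, hε0, hεc⟩ := EReal.lt_iff_exists_real_btwn.1 hc
    have hε : (0 : ℝ) < ε := by exact_mod_cast hε0
    refine (limsup_le_of_le (by isBoundedDefault) ?_).trans hεc.le
    exact (hT.eventually (hFA ξ hξS hA ε hε)).mono fun z hz ↦ by exact_mod_cast hz.le

/-- **Membership in the Perron family.** Under the hypotheses of `limsup_le_indicator` and with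
`F` holomorphic on `𝔻`, `z ↦ Re F (f⁻¹ z)` belongs to the Perron family of `D` with boundary
datum `1_A` (and `0` at `∞`, vacuous since `D` is bounded). [folklore] -/
theorem mem_perronFamily (D : JordanDomain)
    (f : ConformalEquiv (ball (0 : ℂ) 1) D.carrier) {Φ : ℂ → ℂ}
    (hΦc : ContinuousOn Φ (closedBall 0 1)) (hΦf : EqOn Φ f (ball 0 1))
    (hΦbij : BijOn Φ (closedBall 0 1) (closure D.carrier))
    (hΦfr : BijOn Φ (sphere 0 1) (frontier D.carrier)) {A : Set ℂ} {F : ℂ → ℂ}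
    (hF : DifferentiableOn ℂ F (ball 0 1))
    (hF1 : ∀ w ∈ ball (0 : ℂ) 1, (F w).re ≤ 1)
    (hFA : ∀ ζ ∈ sphere (0 : ℂ) 1, Φ ζ ∉ A → ∀ ε : ℝ, 0 < ε →
      ∀ᶠ w in 𝓝[ball 0 1] ζ, (F w).re < ε) :
    (fun z ↦ (((F (f.symm z)).re : ℝ) : EReal)) ∈
      perronFamily D.carrier (A.indicator 1) 0 :=
  mem_perronFamily_of_isBounded D.isBounded (isSubharmonicOn_re_comp_symm D f hF)
    fun _ hζ ↦ limsup_le_indicator D f hΦc hΦf hΦbij hΦfr hF1 hFA hζ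

end HarmonicMeasureTransport

open HarmonicMeasureTransport

/-- **Stub `stub_loopSymmetricLimit_harmonicMeasureTransport`** of the skeleton of the crux
`IsingJetsConformal` (stmt-CriticalPhenomena-5560): for a Jordan domain `D`, a conformal map
`f : 𝔻 → D` with Carathéodory extension `Φ` (continuous on the closed disc, `= f` on `𝔻`,
bijective `D̄(0, 1) → D̄` and `∂𝔻 → ∂D`), a set `A` and `F` holomorphic on `𝔻` with `Re F ≤ 1`
and `Re F` eventually `< ε` (every `ε > 0`) near each `ζ ∈ ∂𝔻` with `Φ ζ ∉ A`, one has
`Re F (w) ≤ ω_D(f w, A)` (Perron harmonic measure) for every `w ∈ 𝔻`: `Re F ∘ f⁻¹` is a member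
of the Perron family of `1_A` (`HarmonicMeasureTransport.mem_perronFamily`) and
`le_harmonicMeasure_of_mem`. [folklore] -/
theorem stub_loopSymmetricLimit_harmonicMeasureTransport : (∀ (D : Literature.Probability.RandomPlanarGeometry.JordanDomain) (f : Literature.Probability.RandomPlanarGeometry.ConformalEquiv (Metric.ball (0 : ℂ) 1) D.carrier) (Φ : ℂ → ℂ), ContinuousOn Φ (Metric.closedBall 0 1) → Set.EqOn Φ f (Metric.ball 0 1) → Set.BijOn Φ (Metric.closedBall 0 1) (closure D.carrier) → Set.BijOn Φ (Metric.sphere 0 1) (frontier D.carrier) → ∀ (A : Set ℂ) (F : ℂ → ℂ), DifferentiableOn ℂ F (Metric.ball 0 1) → (∀ w ∈ Metric.ball (0 : ℂ) 1, (F w).re ≤ 1) → (∀ ζ ∈ Metric.sphere (0 : ℂ) 1, Φ ζ ∉ A → ∀ ε : ℝ, 0 < ε → ∀ᶠ w in nhdsWithin ζ (Metric.ball 0 1), (F w).re < ε) → ∀ w ∈ Metric.ball (0 : ℂ) 1, (F w).re ≤ Literature.Analysis.Potential.harmonicMeasure D.carrier (f w) A) := by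
  intro D f Φ hΦc hΦf hΦbij hΦfr A F hF hF1 hFA w hw
  refine le_harmonicMeasure_of_mem (mem_perronFamily D f hΦc hΦf hΦbij hΦfr hF hF1 hFA) ?_
    (hF1 w hw)
  simp only [f.symm_apply_apply hw, le_refl]

end

end Summit.CriticalPhenomena.CardyFormulaZ2.Theorems.CardyQContinuation
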